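import Summits.BirchSwinnertonDyer.BirchSwinnertonDyer.Theorems.EisensteinPrimesX2AnalyticLambdaResultantCertificate
import Summits.BirchSwinnertonDyer.BirchSwinnertonDyer.Theorems.EisensteinPrimesX1AnalyticLambdaCertificate
import Literature.NumberTheory.EllipticCurves.PAdicBSDProofs
import HarnessLib

/-!
# Route `EisensteinPrimes`, line `mudescent`, crux 5 `MazurMCOnX1RankZero` (X1 currency): the
# analytic inputs of stubs 3 + 4 at a good ORDINARY pair IN EXACT RATIONAL ARITHMETIC — one
# Sylvester resultant of the Mazur–Tate element (helper; closes nothing)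

Seat `bsd-eis-lam-a` g4 (PROGRAMME PART 1b, ACCEL-LIST (4): "ANALYTIC side of
`stub_lambdaCount_offLocus` … X1 and X2 versions"; items stmt-BirchSwinnertonDyer-19035 (this file) /
-19033; skeleton owner bsd-eis-ky, `Lines/mudescent.lean`, X1 skeleton d113fc0a…). The X1 twin of
this seat's `EisensteinPrimesX2AnalyticLambdaResultantCertificate` (§1 there is generic in
`(f, α, L)`; here `α = unitRoot W p`, a unit, `L = L_p(E,T) = padicLFunction f (unitRoot W p)` at
level `N_E`, interpolation = the tree theorem `isPAdicLFunctionOf_padicLFunction_holds`) and of g3's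
`EisensteinPrimesX1AnalyticLambdaCertificate` (p487060: ONE Birch sum for ONE `ℂ_p`-valued
character).

HONEST FRAMING. THEOREMS ONLY — no definition, no new named fact; nothing about any particular curve
is asserted; closes nothing; moves no label. Class-wide the stub stays crux-sized (lam-a g0 CENSUS,
g2 MEMO-2 §4). What is added, per pair on row A3 (good anomalous `p`, `E[p]` reducible):

* §1 `analyticMuLE_zero_and_analyticLambdaEq_of_norm_resultant_eq` — integral model `ι g = ϖ·L_p`
  and `‖ϖ‖^{φ(pⁿ⁺¹)} · ‖Res(Φ_{pⁿ⁺¹}(X+1), θ_{n+1}(f))‖_p = p^{−V}`, `V < φ(pⁿ⁺¹)` ⟹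
  `AnalyticMuLE W p 0 ∧ AnalyticLambdaEq W p V`; the `padicValRat` form
  (`R ≠ 0`, `φ(pⁿ⁺¹)·v_p(ϖ) + v_p(R) = V`); and the `g`-FREE form (if `ϖ·L_p ∉ Λ` the typed `λ`
  statement is vacuous and `μ_an ≤ 0` holds because some coefficient has norm `> 1`,
  `exists_iwasawaToPowerSeries_eq_iff_norm_coeff_le_one`) — so the display hypothesis is THE newform
  `f` at level `N_E`, its `ϖ`, and one rational valuation identity; no `ℂ_p`-valued character.
* §2 stubs 3 + 4 at the X1 pair (registered X1 conclusion `∃ n k, AnalyticLambdaEq W p n ∧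
  AlgebraicLambdaGE W p k ∧ n ≤ k` verbatim), Mazur's main conjecture at the pair (μ-part
  `X1.MuPart.muPartAt_of_analyticMuLE_zero` + route T), the rank-growth road (Greenberg Thm. 1.9,
  binder-free), and END-TO-END on lam-b's δ = 0 road (p471892: `p ∤ #E(ℚ)_tors`, `S` Tamagawa
  places, `V ≤ #S`).

At `p = 5`, `n + 1 = 1` (the `20` symbols `[a/25]⁺_f`, `φ(5) = 4`): decides `λ_an ≤ 3` — 15 of the
21 type-A anomalous lines of MEMO-2 §4 (the generic rank-0 value there is `λ_an = 2`); `n + 1 = 2`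
(`[a/125]⁺_f`, `φ(25) = 20`) decides `λ_an ≤ 19` (all 21).

References: [MazurSwinnertonDyer1974Invent] §9; [MazurTateTeitelbaum1986Invent] §I.8 (8.6),
§I.12–I.14; [Washington1997] §7.1–7.2, Thm. 7.3; [Pollack2003] Def. 6.15, Prop. 6.9;
[GreenbergLNM1716] §5 pp. 114–118, Cor. 5.6 (p. 136), Thm. 1.9; [Wuthrich2014] Thm. 16;
HOME/lam-a-g2/lam-a-MEMO-2.md §4; HOME/lam-a-g4/lam-a-MEMO-4.md.
-/

set_option linter.dupNamespace false
set_option autoImplicit false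

noncomputable section

open scoped Classical MatrixGroups ModularForm

open CongruenceSubgroup WeierstrassCurve NumberField IsDedekindDomain
  Literature.NumberTheory.EllipticCurves
  Literature.NumberTheory.EllipticCurves.ModularForms
  Literature.NumberTheory.EllipticCurves.Rank1Residual
  Literature.NumberTheory.EllipticCurves.GreenbergVatsal2000
  Literature.NumberTheory.EllipticCurves.Greenberg1999
  Literature.NumberTheory.GaloisCohomology
  Summit.BirchSwinnertonDyer.Rank1Residual
  Summit.BirchSwinnertonDyer.Rank1Residual.X1.MuLambda
  Summit.BirchSwinnertonDyer.Rank1Residual.X1.MuPart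
  Summit.BirchSwinnertonDyer.Rank1Residual.X1.ParitySqueeze
  Summit.BirchSwinnertonDyer.Rank1Residual.X1.TamagawaSqueeze
  Summit.BirchSwinnertonDyer.Rank1Residual.X11a
  Summit.BirchSwinnertonDyer.Rank1Residual.X11a.LambdaNorm
  Summit.BirchSwinnertonDyer.Rank1Residual.Iwasawa
  Summit.BirchSwinnertonDyer.BirchSwinnertonDyer.Theorems
  Summit.BirchSwinnertonDyer.BirchSwinnertonDyer.Theorems.Rank1ResidualX1Defs
  Summit.BirchSwinnertonDyer.BirchSwinnertonDyer.Theorems.EisensteinPrimesX1AnalyticLambdaCertificate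
  Summit.BirchSwinnertonDyer.BirchSwinnertonDyer.Theorems.EisensteinPrimesX2AnalyticLambdaResultantCertificate

namespace Summit.BirchSwinnertonDyer.BirchSwinnertonDyer.Theorems.EisensteinPrimesX1AnalyticLambdaResultantCertificate

variable {W : WeierstrassCurve ℚ} [W.IsElliptic] [W.IsGloballyMinimal] {p : ℕ} [hp : Fact p.Prime]

/-! ## §1. X1: the resultant certificate gives the typed analytic inputs (good ordinary `p`) -/

section Certificates

variable [NeZero (W.conductorNorm ℤ)] {f : CuspForm (Gamma0 (W.conductorNorm ℤ)) 2} {ϖ : ℚ}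

/-- **X1: the RESULTANT CERTIFICATE gives `μ_an = 0` AND `λ_an` at a good ORDINARY prime.** `g` an
integral model (`ι g = ϖ·L_p`); if `‖ϖ‖^{φ(pⁿ⁺¹)} · ‖Res(Φ_{pⁿ⁺¹}(X+1), θ_{n+1}(f))‖_p = p^{−V}` with
`V < φ(pⁿ⁺¹)`, then `AnalyticMuLE W p 0 ∧ AnalyticLambdaEq W p V` (interpolation at `α = unitRoot`, a
unit, is the tree theorem; the orbit product over the primitive `pⁿ⁺¹`-th roots of unity is
`‖ϖ‖^φ · ‖Res‖_p` by this seat's X2 file §1). [cite: MazurSwinnertonDyer1974Invent, §9]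
[cite: MazurTateTeitelbaum1986Invent, §I.13–I.14] [cite: Washington1997, §7.1–7.2 and Thm. 7.3] -/
theorem analyticMuLE_zero_and_analyticLambdaEq_of_norm_resultant_eq (hord : IsOrdinaryAt W p)
    (hf : IsNewformOf W f) (hϖ : (ϖ : ℝ) * W.realPeriodRat = plusPeriod f) {g : IwasawaAlgebra p}
    (hg : iwasawaToPowerSeries p g =
      PowerSeries.C (ϖ : ℚ_[p]) * padicLFunction f (unitRoot W p : ℚ_[p]))
    {n V : ℕ} (hV : V < Nat.totient (p ^ (n + 1)))
    (h : ‖(ϖ : ℚ_[p])‖ ^ Nat.totient (p ^ (n + 1)) *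
        ‖((Polynomial.resultant ((Polynomial.cyclotomic (p ^ (n + 1)) ℚ).comp (Polynomial.X + 1))
            (mazurTateElement f p (n + 1)) (Nat.totient (p ^ (n + 1)))
            (mazurTateElement f p (n + 1)).natDegree : ℚ) : ℚ_[p])‖ = ((p : ℝ)⁻¹) ^ V) :
    AnalyticMuLE W p 0 ∧ AnalyticLambdaEq W p V := by
  have hI := (isPAdicLFunctionOf_padicLFunction_holds hord hf).2
  have hα : ∀ k : ℕ, ‖algebraMap ℚ_[p] ℂ_[p] ((unitRoot W p : ℚ_[p])⁻¹ ^ k)‖ = 1 :=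
    norm_algebraMap_unitRoot_inv_pow hord
  have hpV : (0 : ℝ) < ((p : ℝ)⁻¹) ^ V :=
    pow_pos (inv_pos.mpr (by exact_mod_cast hp.out.pos)) V
  -- `g ≠ 0`: otherwise the orbit product vanishes, but `p^{-V} ≠ 0`
  have hg0 : g ≠ 0 := by
    intro hg0
    obtain ⟨ζ₀, hζ₀⟩ := exists_isPrimitiveRoot_padicComplex (p := p) n
    have hprod := prod_norm_tsum_eq_norm_pow_mul_norm_resultant hI hα hg hζ₀
    rw [h, hg0] at hprod
    have hzero : ∏ ζ ∈ primitiveRoots (p ^ (n + 1)) ℂ_[p],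
        ‖∑' k, ((algebraMap ℚ_[p] ℂ_[p]).comp (algebraMap ℤ_[p] ℚ_[p]))
          (PowerSeries.coeff k (0 : IwasawaAlgebra p)) * (ζ - 1) ^ k‖ = 0 := by
      rw [Finset.prod_eq_zero_iff]
      refine ⟨ζ₀, (mem_primitiveRoots (pow_pos hp.out.pos _)).mpr hζ₀, ?_⟩
      simp
    rw [hzero] at hprod
    exact absurd hprod hpV.ne
  obtain ⟨hμ, hlam⟩ := mu_eq_zero_and_lam_eq_of_norm_pow_mul_norm_resultant_eq hI hα hg hg0 hV h
  have hunit : HasUnitContent g := hasUnitContent_of_mu_eq_zero hg0 hμ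
  obtain ⟨k, hk⟩ := (hasUnitContent_iff_exists_norm_eq_one g).mp hunit
  rw [EisensteinPrimesX2AnalyticLambdaCertificate.norm_coeff_eq_of_iota_eq hg] at hk
  refine ⟨analyticMuLE_zero_of_norm_coeff_eq_one hf hϖ hk,
    (analyticLambdaEq_iff_of_datum hf hϖ V).mpr fun g' hg' ↦ ?_⟩
  rw [iwasawaToPowerSeries_injective p (hg'.trans hg.symm), hlam]

/-- **`padicValRat` form** (X1): integral model, `Res ≠ 0` and
`φ(pⁿ⁺¹)·v_p(ϖ) + v_p(Res(Φ_{pⁿ⁺¹}(X+1), θ_{n+1}(f))) = V < φ(pⁿ⁺¹)` ⟹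
`AnalyticMuLE W p 0 ∧ AnalyticLambdaEq W p V`. [cite: MazurSwinnertonDyer1974Invent, §9]
[cite: Washington1997, §7.1–7.2 and Thm. 7.3] -/
theorem analyticMuLE_zero_and_analyticLambdaEq_of_padicValRat_resultant_eq (hord : IsOrdinaryAt W p)
    (hf : IsNewformOf W f) (hϖ : (ϖ : ℝ) * W.realPeriodRat = plusPeriod f) {g : IwasawaAlgebra p}
    (hg : iwasawaToPowerSeries p g =
      PowerSeries.C (ϖ : ℚ_[p]) * padicLFunction f (unitRoot W p : ℚ_[p]))
    {n V : ℕ} (hV : V < Nat.totient (p ^ (n + 1)))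
    (hR : Polynomial.resultant ((Polynomial.cyclotomic (p ^ (n + 1)) ℚ).comp (Polynomial.X + 1))
        (mazurTateElement f p (n + 1)) (Nat.totient (p ^ (n + 1)))
        (mazurTateElement f p (n + 1)).natDegree ≠ 0)
    (h : (Nat.totient (p ^ (n + 1)) : ℤ) * padicValRat p ϖ +
        padicValRat p (Polynomial.resultant
          ((Polynomial.cyclotomic (p ^ (n + 1)) ℚ).comp (Polynomial.X + 1))
          (mazurTateElement f p (n + 1)) (Nat.totient (p ^ (n + 1)))
          (mazurTateElement f p (n + 1)).natDegree) = V) :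
    AnalyticMuLE W p 0 ∧ AnalyticLambdaEq W p V := by
  obtain ⟨hϖ0, -⟩ := EisensteinPrimesAnalyticLambdaCalculus.varpi_ne_zero_and_realPeriodRat_ne_zero hf hϖ
  set R := Polynomial.resultant ((Polynomial.cyclotomic (p ^ (n + 1)) ℚ).comp (Polynomial.X + 1))
    (mazurTateElement f p (n + 1)) (Nat.totient (p ^ (n + 1)))
    (mazurTateElement f p (n + 1)).natDegree with hRdef
  have hr : ϖ ^ Nat.totient (p ^ (n + 1)) * R ≠ 0 := mul_ne_zero (pow_ne_zero _ hϖ0) hR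
  have hv : padicValRat p (ϖ ^ Nat.totient (p ^ (n + 1)) * R) = V := by
    rw [padicValRat.mul (pow_ne_zero _ hϖ0) hR, padicValRat.pow ϖ]
    exact h
  have hnorm := norm_ratCast_eq_of_padicValRat_eq (p := p) hr hv
  rw [Rat.cast_mul, Rat.cast_pow, norm_mul, norm_pow] at hnorm
  exact analyticMuLE_zero_and_analyticLambdaEq_of_norm_resultant_eq hord hf hϖ hg hV hnorm

/-- **`g`-free form** (X1): the same without naming an integral model. If `ϖ·L_p ∈ Λ` this is the
previous theorem; if not, the typed `λ` statement is vacuous and `AnalyticMuLE W p 0` holds because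
some coefficient of `ϖ·L_p` has norm `> 1 > 1/p` (`exists_iwasawaToPowerSeries_eq_iff_norm_coeff_le_one`).
(At a reducible good ordinary `p` Wuthrich 2014 Thm. 16 makes `ϖ·L_p` integral anyway.)
[cite: MazurTateTeitelbaum1986Invent, §I.12–I.14] [cite: Washington1997, §7.1–7.2 and Thm. 7.3] -/
theorem analyticMuLE_zero_and_analyticLambdaEq_of_padicValRat_resultant_eq' (hord : IsOrdinaryAt W p)
    (hf : IsNewformOf W f) (hϖ : (ϖ : ℝ) * W.realPeriodRat = plusPeriod f)
    {n V : ℕ} (hV : V < Nat.totient (p ^ (n + 1)))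
    (hR : Polynomial.resultant ((Polynomial.cyclotomic (p ^ (n + 1)) ℚ).comp (Polynomial.X + 1))
        (mazurTateElement f p (n + 1)) (Nat.totient (p ^ (n + 1)))
        (mazurTateElement f p (n + 1)).natDegree ≠ 0)
    (h : (Nat.totient (p ^ (n + 1)) : ℤ) * padicValRat p ϖ +
        padicValRat p (Polynomial.resultant
          ((Polynomial.cyclotomic (p ^ (n + 1)) ℚ).comp (Polynomial.X + 1))
          (mazurTateElement f p (n + 1)) (Nat.totient (p ^ (n + 1)))
          (mazurTateElement f p (n + 1)).natDegree) = V) :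
    AnalyticMuLE W p 0 ∧ AnalyticLambdaEq W p V := by
  by_cases hex : ∃ g : IwasawaAlgebra p, iwasawaToPowerSeries p g =
      PowerSeries.C (ϖ : ℚ_[p]) * padicLFunction f (unitRoot W p : ℚ_[p])
  · obtain ⟨g, hg⟩ := hex
    exact analyticMuLE_zero_and_analyticLambdaEq_of_padicValRat_resultant_eq hord hf hϖ hg hV hR h
  · -- no integral model: some coefficient has norm `> 1`
    rw [exists_iwasawaToPowerSeries_eq_iff_norm_coeff_le_one, not_forall] at hex
    obtain ⟨k, hk⟩ := hex
    rw [not_le] at hk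
    refine ⟨(analyticMuLE_iff_of_datum hf hϖ 0).mpr ⟨k, lt_trans ?_ hk⟩,
      (analyticLambdaEq_iff_of_datum hf hϖ V).mpr fun g hg ↦ ?_⟩
    · have hp1 : (1 : ℝ) < p := by exact_mod_cast hp.out.one_lt
      have : (p : ℝ) ^ (-(((0 : ℕ) : ℤ) + 1)) = (p : ℝ)⁻¹ := by simp
      rw [this]
      exact inv_lt_one_of_one_lt₀ hp1
    · exact absurd ((exists_iwasawaToPowerSeries_eq_iff_norm_coeff_le_one _).mp ⟨g, hg⟩ k)
        (not_le.mpr hk)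

end Certificates

/-! ## §2. Stubs 3 + 4 at the X1 pair, Mazur's main conjecture at the pair, END-TO-END (δ = 0) -/

section AtPair

variable [NeZero (W.conductorNorm ℤ)] {f : CuspForm (Gamma0 (W.conductorNorm ℤ)) 2} {ϖ : ℚ}

/-- **Stubs 3 and 4 of `mudescent` (X1) AT A PAIR from the resultant certificate**: for THE newform
`f` at level `N_E` and its `ϖ`, the `padicValRat` resultant certificate of layer `n + 1` with value
`V`, `AlgebraicLambdaGE W p k` and `V ≤ k` ⟹ `AnalyticMuLE W p 0` and the registered X1 conclusion
`∃ n k, AnalyticLambdaEq W p n ∧ AlgebraicLambdaGE W p k ∧ n ≤ k`.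
[cite: GreenbergVatsal2000, p. 2–3, (1)–(2)] [cite: GreenbergLNM1716, Cor. 5.6 (p. 136)] -/
theorem lambdaCount_of_padicValRat_resultant_eq_of_algebraicLambdaGE (hord : IsOrdinaryAt W p)
    (hf : IsNewformOf W f) (hϖ : (ϖ : ℝ) * W.realPeriodRat = plusPeriod f)
    {n V : ℕ} (hV : V < Nat.totient (p ^ (n + 1)))
    (hR : Polynomial.resultant ((Polynomial.cyclotomic (p ^ (n + 1)) ℚ).comp (Polynomial.X + 1))
        (mazurTateElement f p (n + 1)) (Nat.totient (p ^ (n + 1)))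
        (mazurTateElement f p (n + 1)).natDegree ≠ 0)
    (h : (Nat.totient (p ^ (n + 1)) : ℤ) * padicValRat p ϖ +
        padicValRat p (Polynomial.resultant
          ((Polynomial.cyclotomic (p ^ (n + 1)) ℚ).comp (Polynomial.X + 1))
          (mazurTateElement f p (n + 1)) (Nat.totient (p ^ (n + 1)))
          (mazurTateElement f p (n + 1)).natDegree) = V)
    {k : ℕ} (halg : AlgebraicLambdaGE W p k) (hVk : V ≤ k) :
    AnalyticMuLE W p 0 ∧ ∃ n k : ℕ, AnalyticLambdaEq W p n ∧ AlgebraicLambdaGE W p k ∧ n ≤ k := by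
  obtain ⟨hμ, hlam⟩ :=
    analyticMuLE_zero_and_analyticLambdaEq_of_padicValRat_resultant_eq' hord hf hϖ hV hR h
  exact ⟨hμ, V, k, hlam, halg, hVk⟩

/-- **Mazur's main conjecture AT AN X1 PAIR from the resultant certificate** (`p ≠ 2` good ordinary,
`E[p]` reducible): + `AlgebraicLambdaGE W p k`, `V ≤ k` ⟹ `MazurMainConjecture W p` (μ-part
`X1.MuPart.muPartAt_of_analyticMuLE_zero` + route T `X1.TamagawaSqueeze.mazurMainConjecture_of_algebraicLambdaGE`,
Wuthrich Thm. 16 `hW16`). [cite: Wuthrich2014, Thm. 16 (p. 397)] [cite: GreenbergVatsal2000, p. 4] -/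
theorem mazurMainConjecture_of_padicValRat_resultant_eq_of_algebraicLambdaGE
    (hW16 : Wuthrich2014.charIdeal_dvd_padicLFunction) (hp2 : p ≠ 2)
    (hgood : W.HasGoodReductionAtPrime p) (hord : ¬ (p : ℤ) ∣ W.frobeniusTrace p)
    (hred : ¬ W.HasIrreducibleModPGaloisRep p)
    (hf : IsNewformOf W f) (hϖ : (ϖ : ℝ) * W.realPeriodRat = plusPeriod f)
    {n V : ℕ} (hV : V < Nat.totient (p ^ (n + 1)))
    (hR : Polynomial.resultant ((Polynomial.cyclotomic (p ^ (n + 1)) ℚ).comp (Polynomial.X + 1))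
        (mazurTateElement f p (n + 1)) (Nat.totient (p ^ (n + 1)))
        (mazurTateElement f p (n + 1)).natDegree ≠ 0)
    (h : (Nat.totient (p ^ (n + 1)) : ℤ) * padicValRat p ϖ +
        padicValRat p (Polynomial.resultant
          ((Polynomial.cyclotomic (p ^ (n + 1)) ℚ).comp (Polynomial.X + 1))
          (mazurTateElement f p (n + 1)) (Nat.totient (p ^ (n + 1)))
          (mazurTateElement f p (n + 1)).natDegree) = V)
    {k : ℕ} (halg : AlgebraicLambdaGE W p k) (hVk : V ≤ k) : MazurMainConjecture W p := by
  obtain ⟨hμ, n', k', hn, halg', hnk⟩ := lambdaCount_of_padicValRat_resultant_eq_of_algebraicLambdaGE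
    ⟨hgood, hord⟩ hf hϖ hV hR h halg hVk
  exact X1.TamagawaSqueeze.mazurMainConjecture_of_algebraicLambdaGE hW16 hp2 hgood hord hred
    (muPartAt_of_analyticMuLE_zero hW16 hp2 hgood hord hred hμ) hn halg' hnk

/-- **X1 pair, RANK-GROWTH road** from the resultant certificate: + a rank-growth certificate
`LayerRankGEAt W p k m` (`rank E(ℚ_k) ≥ m`) with `V ≤ m` ⟹ `MazurMainConjecture W p` (Greenberg
Thm. 1.9 PROVED, binder-free `Iwasawa.algebraicLambdaGE_of_layerRankGEAt'`; route T) — the algebraic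
face of the torsion-point zeros (`186@5`: four of its six zeros at the conductor-`25` characters).
[cite: GreenbergLNM1716, Thm. 1.9 (p. 63)] [cite: Wuthrich2014, Thm. 16 (p. 397)] -/
theorem mazurMainConjecture_of_padicValRat_resultant_eq_of_layerRankGEAt
    (hW16 : Wuthrich2014.charIdeal_dvd_padicLFunction) (hp2 : p ≠ 2)
    (hgood : W.HasGoodReductionAtPrime p) (hord : ¬ (p : ℤ) ∣ W.frobeniusTrace p)
    (hred : ¬ W.HasIrreducibleModPGaloisRep p)
    (hf : IsNewformOf W f) (hϖ : (ϖ : ℝ) * W.realPeriodRat = plusPeriod f)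
    {n V : ℕ} (hV : V < Nat.totient (p ^ (n + 1)))
    (hR : Polynomial.resultant ((Polynomial.cyclotomic (p ^ (n + 1)) ℚ).comp (Polynomial.X + 1))
        (mazurTateElement f p (n + 1)) (Nat.totient (p ^ (n + 1)))
        (mazurTateElement f p (n + 1)).natDegree ≠ 0)
    (h : (Nat.totient (p ^ (n + 1)) : ℤ) * padicValRat p ϖ +
        padicValRat p (Polynomial.resultant
          ((Polynomial.cyclotomic (p ^ (n + 1)) ℚ).comp (Polynomial.X + 1))
          (mazurTateElement f p (n + 1)) (Nat.totient (p ^ (n + 1)))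
          (mazurTateElement f p (n + 1)).natDegree) = V)
    {k m : ℕ} (hm : LayerRankGEAt W p k m) (hVm : V ≤ m) : MazurMainConjecture W p :=
  mazurMainConjecture_of_padicValRat_resultant_eq_of_algebraicLambdaGE hW16 hp2 hgood hord hred hf hϖ
    hV hR h (algebraicLambdaGE_of_layerRankGEAt' (Or.inl ⟨hgood, hord⟩) hm) hVm

/-- **END-TO-END at an X1 member WITHOUT rational `p`-torsion from the resultant certificate**
(lam-b's δ = 0 road p471892): `p ≠ 2` good ordinary, `E[p]` reducible, `p ∤ #E(ℚ)_tors`, `S` places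
`v ∤ p` with `p ∣ c_v(W)`, the resultant certificate with value `V ≤ #S` ⟹ `MazurMainConjecture W p`.
Named print: `hW16`, `hPT`, `h415`, `hmod`. Per pair: one rational determinant and one integer.
[cite: GreenbergLNM1716, §5 pp. 114–118 and Cor. 5.6 (p. 136)] [cite: Wuthrich2014, Thm. 16 (p. 397)] -/
theorem mazurMainConjecture_of_padicValRat_resultant_eq_of_dvd_localTamagawaNumber (hp2 : p ≠ 2)
    (hPT : poitouTate_selmerStructure_duality ℚ)
    (h415 : prop415ii_noFiniteSubmodule_of_ordinary_or_multiplicative)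
    (hW16 : Wuthrich2014.charIdeal_dvd_padicLFunction) (hmod : nonempty_modularParametrizationData)
    (hgood : W.HasGoodReductionAtPrime p) (hord : ¬ (p : ℤ) ∣ W.frobeniusTrace p)
    (hred : ¬ W.HasIrreducibleModPGaloisRep p) (htors : ¬ p ∣ W.torsionOrder)
    (S : Finset (HeightOneSpectrum (𝓞 ℚ))) (hSp : ∀ v ∈ S, ((p : ℕ) : 𝓞 ℚ) ∉ v.asIdeal)
    (hcv : ∀ v ∈ S,
      p ∣ (W.baseChange (v.adicCompletion ℚ)).localTamagawaNumber (v.adicCompletionIntegers ℚ))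
    (hf : IsNewformOf W f) (hϖ : (ϖ : ℝ) * W.realPeriodRat = plusPeriod f)
    {n V : ℕ} (hV : V < Nat.totient (p ^ (n + 1)))
    (hR : Polynomial.resultant ((Polynomial.cyclotomic (p ^ (n + 1)) ℚ).comp (Polynomial.X + 1))
        (mazurTateElement f p (n + 1)) (Nat.totient (p ^ (n + 1)))
        (mazurTateElement f p (n + 1)).natDegree ≠ 0)
    (h : (Nat.totient (p ^ (n + 1)) : ℤ) * padicValRat p ϖ +
        padicValRat p (Polynomial.resultant
          ((Polynomial.cyclotomic (p ^ (n + 1)) ℚ).comp (Polynomial.X + 1))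
          (mazurTateElement f p (n + 1)) (Nat.totient (p ^ (n + 1)))
          (mazurTateElement f p (n + 1)).natDegree) = V)
    (hVS : V ≤ S.card) : MazurMainConjecture W p := by
  obtain ⟨hμ, -⟩ :=
    analyticMuLE_zero_and_analyticLambdaEq_of_padicValRat_resultant_eq' ⟨hgood, hord⟩ hf hϖ hV hR h
  have halg : AlgebraicLambdaGE W p (S.card - 0) :=
    EisensteinPrimesX1AlgebraicLambdaGEBudget.X1.algebraicLambdaGE_of_dvd_localTamagawaNumber hp2 hPT
      h415 hW16 hmod hgood hord hred htors S hSp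
      hcv hμ
  rw [Nat.sub_zero] at halg
  exact mazurMainConjecture_of_padicValRat_resultant_eq_of_algebraicLambdaGE hW16 hp2 hgood hord hred
    hf hϖ hV hR h halg hVS

end AtPair

end Summit.BirchSwinnertonDyer.BirchSwinnertonDyer.Theorems.EisensteinPrimesX1AnalyticLambdaResultantCertificate

end
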